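import Mathlib
import Summits.Ventures.HodgeRepro.Tier4.Target
import Summits.Ventures.HodgeRepro.Tier4.Line3.Defs
import Summits.Ventures.HodgeRepro.Tier4.Line3.DefsLemmas
import Summits.Ventures.HodgeRepro.Tier4.Line3.GaussRatioFormula
import Summits.Ventures.HodgeRepro.Tier4.Line3.CopyRemainder
import Summits.Ventures.HodgeRepro.Tier4.Line3.CopyWeightGaussian
import Summits.Ventures.HodgeRepro.Tier4.Line3.CopyWeightBoundShrink
import Summits.Ventures.HodgeRepro.Tier4.Line3.CopyWeightBoundShrinkRed
import Summits.Ventures.HodgeRepro.Tier4.Line3.LatticeGaussSummable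
import Summits.Ventures.HodgeRepro.Tier4.Line3.CopyCountSummable
import Summits.Ventures.HodgeRepro.Tier4.Line3.ShrinkMajGauss
import Summits.Ventures.HodgeRepro.Tier4.Line3.GaussCountRay
import Summits.Ventures.HodgeRepro.Tier4.Line3.CopyCountShrink
import Summits.Ventures.HodgeRepro.Tier4.Line3.CopyCountRay

/-!
# Tier4/Line3/CopyCountRayRed — the pure count along the integer ray for the SIGNED majorant

Blind re-derivation cell `pub-hodge-repro`, Tier 4 «PROVE THE STEP», LINE L3, seat t4-x2 (g3, reserve wall-breaker); the
reduced-majorant version of CopyCountRay (self-correction of bus S14086).  The signed majorant of CopyWeightBoundShrinkRed,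
`shrinkMajRed A k ε xm = shrinkW A k ε · exp(−π profileExc ε xm)`, factors along the ray exactly as the one-sided one
(`profileExc` is linear in the sizes: `profileExc_rayCentre`, `shrinkMajRed_rayCentre`), is at most `e^{π Σ_j tauSize (xm j)}`
times the one-sided majorant (so the base count is summable, `summable_base_count_red`, and the `Summable` half holds at every
scale, `summable_copyCount_shrinkMajRed`), and therefore:

  **`eventually_copyCount_rayCentre_red`**: under integral admissible scalars, a centre with non-zero slots, phases bounded
  by `Λ₀` at every scale, and the STRICT SIGNED PROFILE CONDITION `profileExc ε xm > 0` on the non-norm-one admissible tuples,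
  for every `θ > 0` the count over the copies of `n • xm` with the majorant `shrinkMajRed A k (rep o) (n • xm) · ‖Λ(o)‖` is
  summable and `≤ θ` from some scale on.

Together with `weight_le_shrinkMajRed` under the `n`-UNIFORM display `MajorantMomentBoundRed D (n • xm) A k` this is the
honest shape of (R-a′) along the ray: (HK′ uniform) ∧ (phases) ∧ (signed profile condition) ⟹ `ArchCopyBound` at `n • xm`
for `n` large (the assembly through `CopyMajorant` / `archCopyBound_of_majorant` is the planner's, in the skeleton).

Nothing here says anything about the status of the Hodge conjecture for CM abelian varieties, which is NOT proved
(HC_CM is NOT proved by anyone in this repository).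
-/

set_option autoImplicit false

noncomputable section

namespace Summit.Ventures.HodgeRepro.Tier4.Line3

open Summit.Ventures.HodgeRepro.Tier4
open Matrix NumberField Filter Topology
open scoped ComplexConjugate
open scoped Classical

namespace T4Data

variable (X : T4Data)

/-- The signed profile exponent scales by `n²` along the ray. -/
theorem profileExc_rayCentre (ε : Fin 4 → X.E) (xm : X.Tuple) (n : ℕ) :
    X.profileExc ε (X.rayCentre xm n) = (n : ℝ) ^ 2 * X.profileExc ε xm := by
  unfold profileExc
  rw [X.defSize_rayCentre]
  have e1 : (∑ j, (‖X.τ₀ (ε j)‖ ^ 2 - 1) * X.tauSize (X.rayCentre xm n j)) =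
      (n : ℝ) ^ 2 * ∑ j, (‖X.τ₀ (ε j)‖ ^ 2 - 1) * X.tauSize (xm j) := by
    rw [Finset.mul_sum]
    refine Finset.sum_congr rfl fun j _ => ?_
    rw [X.tauSize_rayCentre]
    ring
  rw [e1]
  ring

/-- **THE SIGNED MAJORANT ALONG THE RAY**: `shrinkMajRed A k ε (n • xm) = shrinkW A k ε · exp(−π n² profileExc ε xm)`. -/
theorem shrinkMajRed_rayCentre (A k : ℝ) (ε : Fin 4 → X.E) (xm : X.Tuple) (n : ℕ) :
    X.shrinkMajRed A k ε (X.rayCentre xm n) =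
      X.shrinkW A k ε * Real.exp (-(Real.pi * (n : ℝ) ^ 2 * X.profileExc ε xm)) := by
  unfold shrinkMajRed shrinkW
  rw [X.profileExc_rayCentre]
  ring_nf

/-- At the base scale. -/
theorem shrinkMajRed_eq_shrinkW_mul (A k : ℝ) (ε : Fin 4 → X.E) (xm : X.Tuple) :
    X.shrinkMajRed A k ε xm = X.shrinkW A k ε * Real.exp (-(Real.pi * X.profileExc ε xm)) := by
  have := X.shrinkMajRed_rayCentre A k ε xm 1
  rw [X.rayCentre_one] at this
  simpa using this

/-- The base count for the signed majorant is summable (comparison with the one-sided majorant). -/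
theorem summable_base_count_red {S : Set (Fin 4 → X.E)} (hS : X.IntegralScalars S) {xm : X.Tuple}
    (hx : ∀ j, xm j ≠ 0) {A k : ℝ} (hA : 0 ≤ A) (hk : 0 ≤ k) {Λ₀ : ℝ} (hΛ0 : 0 ≤ Λ₀) :
    Summable fun ε : X.NonNormOne S => X.shrinkW A k ε.1 * Λ₀ * Real.exp (-(Real.pi * X.profileExc ε.1 xm)) := by
  have hbase := X.summable_base_count hS hx hA hk hΛ0 (S := S)
  refine Summable.of_nonneg_of_le (fun ε => ?_) (fun ε => ?_)
    (hbase.mul_left (Real.exp (Real.pi * ∑ j, X.tauSize (xm j))))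
  · exact mul_nonneg (mul_nonneg (X.shrinkW_nonneg hA k _) hΛ0) (Real.exp_pos _).le
  · have h1 := X.shrinkMajRed_le_shrinkMaj hA k ε.1 xm
    rw [X.shrinkMajRed_eq_shrinkW_mul, X.shrinkMaj_eq_shrinkW_mul] at h1
    have h2 := mul_le_mul_of_nonneg_right h1 hΛ0
    calc X.shrinkW A k ε.1 * Λ₀ * Real.exp (-(Real.pi * X.profileExc ε.1 xm))
        = X.shrinkW A k ε.1 * Real.exp (-(Real.pi * X.profileExc ε.1 xm)) * Λ₀ := by ring
      _ ≤ Real.exp (Real.pi * ∑ j, X.tauSize (xm j)) *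
          (X.shrinkW A k ε.1 * Real.exp (-(Real.pi * X.profileExcPlus ε.1 xm))) * Λ₀ := h2
      _ = Real.exp (Real.pi * ∑ j, X.tauSize (xm j)) *
          (X.shrinkW A k ε.1 * Λ₀ * Real.exp (-(Real.pi * X.profileExcPlus ε.1 xm))) := by ring

/-- The `Summable` half of the count for the signed majorant at any centre with non-zero slots. -/
theorem summable_copyCount_shrinkMajRed {D : X.ThetaData} {S : Set (Fin 4 → X.E)} {xm : X.Tuple}
    (hS : X.IntegralScalars S) (hx : ∀ j, xm j ≠ 0) (c : X.CopyData D S xm) {A k : ℝ} (hA : 0 ≤ A) (hk : 0 ≤ k)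
    {Λ₀ : ℝ} (hΛ : ∀ o ∈ X.Copies S xm, ‖c.lam o 0 * c.lam o 1 * conj (c.lam o 2 * c.lam o 3)‖ ≤ Λ₀) :
    Summable fun o => if o ∈ X.Copies S xm ∧ o ≠ X.orbitOf (X.lines xm) then
      X.shrinkMajRed A k (c.rep o) xm * ‖c.lam o 0 * c.lam o 1 * conj (c.lam o 2 * c.lam o 3)‖ else 0 := by
  have h := (X.summable_copyCount_shrinkMaj hS hx c hA hk hΛ).mul_left (Real.exp (Real.pi * ∑ j, X.tauSize (xm j)))
  refine Summable.of_nonneg_of_le (fun o => ?_) (fun o => ?_) h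
  · split_ifs
    · have h1 : 0 ≤ X.shrinkMajRed A k (c.rep o) xm := by
        rw [X.shrinkMajRed_eq_shrinkW_mul]
        exact mul_nonneg (X.shrinkW_nonneg hA k _) (Real.exp_pos _).le
      exact mul_nonneg h1 (norm_nonneg _)
    · exact le_rfl
  · split_ifs
    · have h1 := mul_le_mul_of_nonneg_right (X.shrinkMajRed_le_shrinkMaj hA k (c.rep o) xm)
        (norm_nonneg (c.lam o 0 * c.lam o 1 * conj (c.lam o 2 * c.lam o 3)))
      calc X.shrinkMajRed A k (c.rep o) xm * ‖c.lam o 0 * c.lam o 1 * conj (c.lam o 2 * c.lam o 3)‖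
          ≤ Real.exp (Real.pi * ∑ j, X.tauSize (xm j)) * X.shrinkMaj A k (c.rep o) xm *
            ‖c.lam o 0 * c.lam o 1 * conj (c.lam o 2 * c.lam o 3)‖ := h1
        _ = Real.exp (Real.pi * ∑ j, X.tauSize (xm j)) *
            (X.shrinkMaj A k (c.rep o) xm * ‖c.lam o 0 * c.lam o 1 * conj (c.lam o 2 * c.lam o 3)‖) := by ring
    · simp

/-- **THE COUNT FOR THE SIGNED MAJORANT AT `n • xm` IS BOUNDED BY THE GAUSSIAN COUNT OVER THE NON-NORM-ONE TUPLES**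
(`n ≥ 1`, signed profile exponents `≥ 0`). -/
theorem copyCount_rayCentre_le_red {D : X.ThetaData} {S : Set (Fin 4 → X.E)} (hS : X.IntegralScalars S)
    {xm : X.Tuple} (hx : ∀ j, xm j ≠ 0) {n : ℕ} (hn : 1 ≤ n) (c : X.CopyData D S (X.rayCentre xm n)) {A k : ℝ}
    (hA : 0 ≤ A) (hk : 0 ≤ k) {Λ₀ : ℝ} (hΛ0 : 0 ≤ Λ₀)
    (hΛ : ∀ o ∈ X.Copies S (X.rayCentre xm n), ‖c.lam o 0 * c.lam o 1 * conj (c.lam o 2 * c.lam o 3)‖ ≤ Λ₀)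
    (hprof : ∀ ε ∈ X.NonNormOne S, 0 ≤ X.profileExc ε xm) :
    (∑' o, if o ∈ X.Copies S (X.rayCentre xm n) ∧ o ≠ X.orbitOf (X.lines (X.rayCentre xm n)) then
      X.shrinkMajRed A k (c.rep o) (X.rayCentre xm n) * ‖c.lam o 0 * c.lam o 1 * conj (c.lam o 2 * c.lam o 3)‖
      else 0) ≤
    gaussCount (fun ε : X.NonNormOne S => X.shrinkW A k ε.1 * Λ₀) (fun ε => X.profileExc ε.1 xm) n := by
  have hbase := X.summable_base_count_red hS hx hA hk hΛ0 (S := S)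
  have hw0 : ∀ ε : X.NonNormOne S, 0 ≤ X.shrinkW A k ε.1 * Λ₀ := fun ε => mul_nonneg (X.shrinkW_nonneg hA k _) hΛ0
  have hE0 : ∀ ε : X.NonNormOne S, 0 ≤ X.profileExc ε.1 xm := fun ε => hprof ε.1 ε.2
  have hg : Summable fun ε : X.NonNormOne S =>
      X.shrinkW A k ε.1 * Λ₀ * Real.exp (-(Real.pi * (n : ℝ) ^ 2 * X.profileExc ε.1 xm)) :=
    summable_gauss_ray hw0 hE0 hbase hn
  set W : X.Orbit → ℝ := fun o => X.shrinkMajRed A k (c.rep o) (X.rayCentre xm n) *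
    ‖c.lam o 0 * c.lam o 1 * conj (c.lam o 2 * c.lam o 3)‖ with hW
  have hle : ∀ o : X.NonMainCopies S (X.rayCentre xm n), W o.1 ≤
      X.shrinkW A k (c.nnRep o).1 * Λ₀ * Real.exp (-(Real.pi * (n : ℝ) ^ 2 * X.profileExc (c.nnRep o).1 xm)) := by
    intro o
    simp only [hW, CopyData.nnRep]
    rw [X.shrinkMajRed_rayCentre]
    have h1 := hΛ o.1 o.2.1
    have h2 : 0 ≤ X.shrinkW A k (c.rep o.1) * Real.exp (-(Real.pi * (n : ℝ) ^ 2 * X.profileExc (c.rep o.1) xm)) :=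
      mul_nonneg (X.shrinkW_nonneg hA k _) (Real.exp_pos _).le
    calc X.shrinkW A k (c.rep o.1) * Real.exp (-(Real.pi * (n : ℝ) ^ 2 * X.profileExc (c.rep o.1) xm)) *
          ‖c.lam o.1 0 * c.lam o.1 1 * conj (c.lam o.1 2 * c.lam o.1 3)‖
        ≤ X.shrinkW A k (c.rep o.1) * Real.exp (-(Real.pi * (n : ℝ) ^ 2 * X.profileExc (c.rep o.1) xm)) * Λ₀ :=
          mul_le_mul_of_nonneg_left h1 h2
      _ = X.shrinkW A k (c.rep o.1) * Λ₀ * Real.exp (-(Real.pi * (n : ℝ) ^ 2 * X.profileExc (c.rep o.1) xm)) := by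
          ring
  have hW0 : ∀ o, 0 ≤ W o := fun o => by
    have h1 : 0 ≤ X.shrinkMajRed A k (c.rep o) (X.rayCentre xm n) := by
      rw [X.shrinkMajRed_rayCentre]
      exact mul_nonneg (X.shrinkW_nonneg hA k _) (Real.exp_pos _).le
    exact mul_nonneg h1 (norm_nonneg _)
  have hf : Summable fun o : X.NonMainCopies S (X.rayCentre xm n) => W o.1 :=
    Summable.of_nonneg_of_le (fun o => hW0 o.1) hle (hg.comp_injective c.nnRep_injective)
  have hind : (∑' o, if o ∈ X.Copies S (X.rayCentre xm n) ∧ o ≠ X.orbitOf (X.lines (X.rayCentre xm n)) then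
      X.shrinkMajRed A k (c.rep o) (X.rayCentre xm n) * ‖c.lam o 0 * c.lam o 1 * conj (c.lam o 2 * c.lam o 3)‖
      else 0) = ∑' o : X.NonMainCopies S (X.rayCentre xm n), W o.1 := by
    rw [tsum_subtype]
    refine tsum_congr fun o => ?_
    simp only [Set.indicator_apply, NonMainCopies, Set.mem_setOf_eq, hW]
  rw [hind]
  unfold gaussCount
  exact hf.tsum_le_tsum_of_inj c.nnRep c.nnRep_injective
    (fun ε _ => mul_nonneg (hw0 ε) (Real.exp_pos _).le) hle hg

/-- **THE PURE COUNT ALONG THE RAY FOR THE SIGNED MAJORANT, UNDER THE STRICT SIGNED PROFILE CONDITION**: for every `θ > 0`,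
from some scale on, the count over the copies of `n • xm` with the majorant `shrinkMajRed A k (rep o) (n • xm) · ‖Λ(o)‖` is
summable and `≤ θ`. -/
theorem eventually_copyCount_rayCentre_red {D : X.ThetaData} {S : Set (Fin 4 → X.E)} (hS : X.IntegralScalars S)
    {xm : X.Tuple} (hx : ∀ j, xm j ≠ 0) (c : ∀ n : ℕ, X.CopyData D S (X.rayCentre xm n)) {A k : ℝ} (hA : 0 ≤ A)
    (hk : 0 ≤ k) {Λ₀ : ℝ} (hΛ0 : 0 ≤ Λ₀)
    (hΛ : ∀ n, ∀ o ∈ X.Copies S (X.rayCentre xm n),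
      ‖(c n).lam o 0 * (c n).lam o 1 * conj ((c n).lam o 2 * (c n).lam o 3)‖ ≤ Λ₀)
    (hprof : ∀ ε ∈ X.NonNormOne S, 0 < X.profileExc ε xm) {θ : ℝ} (hθ : 0 < θ) :
    ∀ᶠ n : ℕ in atTop,
      (Summable fun o => if o ∈ X.Copies S (X.rayCentre xm n) ∧ o ≠ X.orbitOf (X.lines (X.rayCentre xm n)) then
        X.shrinkMajRed A k ((c n).rep o) (X.rayCentre xm n) *
          ‖(c n).lam o 0 * (c n).lam o 1 * conj ((c n).lam o 2 * (c n).lam o 3)‖ else 0) ∧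
      (∑' o, if o ∈ X.Copies S (X.rayCentre xm n) ∧ o ≠ X.orbitOf (X.lines (X.rayCentre xm n)) then
        X.shrinkMajRed A k ((c n).rep o) (X.rayCentre xm n) *
          ‖(c n).lam o 0 * (c n).lam o 1 * conj ((c n).lam o 2 * (c n).lam o 3)‖ else 0) ≤ θ := by
  have hbase := X.summable_base_count_red hS hx hA hk hΛ0 (S := S)
  have hw0 : ∀ ε : X.NonNormOne S, 0 ≤ X.shrinkW A k ε.1 * Λ₀ := fun ε => mul_nonneg (X.shrinkW_nonneg hA k _) hΛ0
  have hE : ∀ ε : X.NonNormOne S, 0 < X.profileExc ε.1 xm := fun ε => hprof ε.1 ε.2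
  have htail := eventually_tsum_gauss_ray_le hw0 hE hbase hθ
  filter_upwards [htail, Filter.eventually_ge_atTop 1] with n hn hn1
  refine ⟨X.summable_copyCount_shrinkMajRed hS (X.rayCentre_ne_zero hx hn1) (c n) hA hk (hΛ n), ?_⟩
  exact (X.copyCount_rayCentre_le_red hS hx hn1 (c n) hA hk hΛ0 (hΛ n) fun ε hε => (hprof ε hε).le).trans hn

end T4Data

end Summit.Ventures.HodgeRepro.Tier4.Line3

end
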